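import Mathlib
import HarnessLib
import Summits.Ventures.HSemireg.GridBarrierNormLaw

/-!
# Venture HSemireg — THEOREM GRID, step (ii): the corner expansion of a two-node symbol and the grid
law `κκ' = r₁r₂ · ∏c · (t₁ − t₂)^{2n}` in the exterior-algebra model, every `n`

HONEST FRAMING. Lean leaf 3a for the computation cell `pub-hsemireg` (target seat t-5 gen 11; file of
record `run/shared/lean/pub/pub-hsemireg/target-g6/GRID-BARRIER-t5g9.md`, §0–§5 and §11, 2026-08-23).
THEOREM GRID there: a box-product / secant-type object `Φ(F₁ ⊠ F₂)` on a Weil-type abelian `2n`-fold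
can carry a class-exact Weil-alive (twisted) Chern character `v = r₁e^{t₁h} + r₂e^{t₂h} + λw + λ'w̄`
only if (i) the nodes are `K`-conjugate, (ii) the GRID LAW `N(λ) = N(r)·∏cₐ·|t − t̄|^{2n}` holds,
(iii) hence `∏cₐ ∈ N(K^*)` — the datum is SPLIT. Leaves 1–2 (`GridBarrierNormKernel.lean`,
`GridBarrierNormLaw.lean`) kernel-check the arithmetic (ii) ⇒ (iii). THIS FILE kernel-checks, for
every `n`, the exterior-algebra computation behind (ii) — the note's §2 «two-node classes are
grid-type with `1/μ = λλ'/(± r₁r₂ ∏c (t₁ − t₂)^{2n})`», there a pencil computation plus machine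
checks at `n = 2, 3, 4` (gridn.py; red-3's independent RED-3-grid_check*.py). The companion leaf 3b
`GridBarrierCornerSplit.lean` discharges the independence hypothesis from the coordinate vectors and
composes the law with leaf 2 (`K`-conjugate data ⇒ `∏c ∈ N(ℚ(ω))`; `∏c = 2` impossible).

* MODEL (note §1). The Hodge classes `⊕ₚ H^{p,p}` of the diagonal CM anchor form the top exterior
  power `Λ^{2n}V` of `V = H^{1,0} ⊕ (H^{0,1})^*`; we work in `ExteriorAlgebra F M` for an arbitrary
  module `M` over a field `F` (the identities need no basis) with vectors `xₐ, yₐ` (σ-slots `a < n`,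
  weights `cₐ`) and `x'_b, y'_b` (σ̄-slots `b < m`, weights `c'_b`; `m = n` for a Weil datum). Node
  vectors `νₐ(t) = yₐ + t cₐ xₐ`; node spinor `N[t] = Q[t]·Q'[t]`, `Q[t] = ν₁(t) ∧ ⋯ ∧ νₙ(t)`
  (σ-slots), `Q'[t]` (σ̄-slots) — the symbol of `e^{th}`; `E = ∏ₐ xₐ ∧ yₐ`, `E' = ∏_b x'_b ∧ y'_b` —
  the symbols of `w`, `w̄` up to the note's dictionary signs (`w ↔ −vol(S₁ ⊕ ⋯ ⊕ Sₙ)`,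
  `w̄ ↔ ∓vol(…)`), which enter only through the Weil coefficients `κ = ±λ`, `κ' = ±λ'` below.
* PROVED (all `n`, `m`; no new definitions): `slot_nu_mul_nu` (`νₐ(t₁) ∧ νₐ(t₂) = cₐ(t₁ − t₂)·xₐ ∧ yₐ`);
  the riffle sign `∏ₐ(uₐvₐ) = (−1)^{C(k,2)}(∏uₐ)(∏vₐ)` and the block swap `(∏ᵢuᵢ)(∏ⱼvⱼ) =
  (−1)^{jk}(∏ⱼvⱼ)(∏ᵢuᵢ)` for generators; hence `(∏cₐ)(t₁ − t₂)ⁿ · E = (−1)^{C(n,2)} · Q[t₁]Q[t₂]`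
  (`smul_E_eq_smul_QQ`: the `w`-corner IS the mixed node corner `vol(Q₁₃ ⊕ Q₂₃)`); the CORNER
  EXPANSION of the two-node symbol `r₁N[t₁] + r₂N[t₂] + κE + κ'E'` on the four corners
  `{Q[t₁]Q'[t₁], Q[t₂]Q'[t₂]; Q[t₁]Q[t₂], Q'[t₁]Q'[t₂]}` (`twoNode_corner_expansion`) and of a product
  of two two-spinor factors `(αQ[t₁] + α'Q'[t₂])(δQ'[t₁] + δ'Q[t₂])` (`boxProduct_corner_expansion`:
  coefficients `αδ, (−1)^{mn}α'δ', αδ', (−1)^{m²}α'δ`, so `c₁c₂ = c₃c₄` — grid invariant `μ = 1`);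
  THE GRID LAW `gridLaw_of_boxProduct` (`m = n`): if the two-node symbol equals such a product and
  the four corners are linearly independent, then `κκ' = r₁r₂ · (∏cₐ∏c'_b) · (t₁ − t₂)^{2n}`.
* NOT FORMALISED (pencil + machine in the note, unchanged): the symbol dictionary itself (§1),
  «a ⊠-type object's symbol is a product of two two-spinor factors ON THIS GRID» (uniqueness of the
  canonical pair `(M₁, M₂)`, §2–§3; the catalecticant classification of ⊠-type elements of `R`), and
  corner reality ⇒ `K`-conjugate nodes (§4). No object is constructed, no semiregularity map is
  computed; nothing here bears on HC, HC_CM or HC_AV.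

Sign conventions: in this frame the law carries NO sign (`κκ' = r₁r₂∏cΔ^{2n}`); the note's `(−1)ⁿ`
(gridn.py) is absorbed in the dictionary signs of `w, w̄` (red-3 §252 (1)); step (iii) uses `|law|`
only (leaf 3b accepts either sign).
-/

namespace Summit.Ventures.HSemireg

open ExteriorAlgebra

section OddCalculus

variable {F : Type*} [CommRing F] {M : Type*} [AddCommGroup M] [Module F M]

/-- `ι u * ι v = -(ι v * ι u)` in the exterior algebra. [folklore] -/
theorem iota_mul_iota_eq_neg (u v : M) : ι F u * ι F v = -(ι F v * ι F u) :=
  eq_neg_of_add_eq_zero_left (ι_add_mul_swap u v)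

/-- Moving one generator past a product of `k` generators costs `(-1)^k`. [folklore] -/
theorem iota_mul_prod_map_iota (u : M) (l : List M) :
    ι F u * (l.map (ι F)).prod = ((-1 : F) ^ l.length) • ((l.map (ι F)).prod * ι F u) := by
  induction l with
  | nil => simp
  | cons v l ih =>
    simp only [List.map_cons, List.prod_cons, List.length_cons]
    rw [← mul_assoc, iota_mul_iota_eq_neg, neg_mul, mul_assoc, ih, mul_smul_comm, pow_succ,
      mul_neg_one, neg_smul, mul_assoc]

/-- Moving a product of `j` generators past a product of `k` generators costs `(-1)^(j k)`.
[folklore] -/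
theorem prod_map_iota_mul_prod_map_iota (l₁ l₂ : List M) :
    (l₁.map (ι F)).prod * (l₂.map (ι F)).prod =
      ((-1 : F) ^ (l₁.length * l₂.length)) • ((l₂.map (ι F)).prod * (l₁.map (ι F)).prod) := by
  induction l₁ with
  | nil => simp
  | cons u l₁ ih =>
    simp only [List.map_cons, List.prod_cons, List.length_cons]
    rw [mul_assoc, ih, mul_smul_comm, ← mul_assoc, iota_mul_prod_map_iota, smul_mul_assoc,
      smul_smul, mul_assoc, ← pow_add]
    congr 2
    ring

/-- The riffle sign: `∏ₐ (ι uₐ * ι vₐ) = (-1)^(k choose 2) • (∏ₐ ι uₐ) * (∏ₐ ι vₐ)` for `k` pairs.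
[folklore] -/
theorem prod_map_pair (l : List (M × M)) :
    (l.map fun p => ι F p.1 * ι F p.2).prod =
      ((-1 : F) ^ (l.length.choose 2)) •
        ((l.map fun p => ι F p.1).prod * (l.map fun p => ι F p.2).prod) := by
  induction l with
  | nil => simp
  | cons p l ih =>
    simp only [List.map_cons, List.prod_cons, List.length_cons]
    rw [ih, mul_smul_comm]
    have hmove : ι F p.2 * (l.map fun q => ι F q.1).prod =
        ((-1 : F) ^ l.length) • ((l.map fun q => ι F q.1).prod * ι F p.2) := by
      have := iota_mul_prod_map_iota (F := F) p.2 (l.map Prod.fst)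
      simpa only [List.map_map, List.length_map, Function.comp_def] using this
    -- (ι p.1 * ι p.2) * (A * B) = ι p.1 * ((ι p.2 * A) * B)
    have hre : ι F p.1 * ι F p.2 *
          ((l.map fun q => ι F q.1).prod * (l.map fun q => ι F q.2).prod)
        = ι F p.1 * ((ι F p.2 * (l.map fun q => ι F q.1).prod) *
          (l.map fun q => ι F q.2).prod) := by
      simp only [mul_assoc]
    rw [hre, hmove, smul_mul_assoc, mul_smul_comm, smul_smul, Nat.choose_succ_succ',
      Nat.choose_one_right, pow_add]
    congr 1
    · ring
    · simp only [mul_assoc]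

/-- Scalars pull out of a product: `∏ₐ (cₐ • zₐ) = (∏ₐ cₐ) • ∏ₐ zₐ`. [folklore] -/
theorem prod_map_smul (l : List (F × ExteriorAlgebra F M)) :
    (l.map fun p => p.1 • p.2).prod = (l.map Prod.fst).prod • (l.map Prod.snd).prod := by
  induction l with
  | nil => simp
  | cons p l ih =>
    simp only [List.map_cons, List.prod_cons]
    rw [ih, smul_mul_smul_comm]

/-- The one-slot identity: `ν(t₁) ∧ ν(t₂) = c (t₁ − t₂) · x ∧ y` for `ν(t) = y + t c x`.
[folklore] -/
theorem slot_nu_mul_nu (x y : M) (c t₁ t₂ : F) :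
    ι F (y + (t₁ * c) • x) * ι F (y + (t₂ * c) • x) = (c * (t₁ - t₂)) • (ι F x * ι F y) := by
  simp only [map_add, map_smul, add_mul, mul_add, smul_mul_assoc, mul_smul_comm, ι_sq_zero,
    smul_zero, zero_add, add_zero]
  rw [iota_mul_iota_eq_neg y x, smul_neg, ← neg_smul, ← add_smul]
  congr 1
  ring

/-- `Fin`-indexed form of `prod_map_iota_mul_prod_map_iota`. [folklore] -/
theorem ofFn_iota_mul_ofFn_iota {j k : ℕ} (v : Fin j → M) (w : Fin k → M) :
    (List.ofFn fun i => ι F (v i)).prod * (List.ofFn fun i => ι F (w i)).prod =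
      ((-1 : F) ^ (j * k)) •
        ((List.ofFn fun i => ι F (w i)).prod * (List.ofFn fun i => ι F (v i)).prod) := by
  have hv : (List.ofFn fun i => ι F (v i)) = (List.ofFn v).map (ι F) := by rw [List.map_ofFn]; rfl
  have hw : (List.ofFn fun i => ι F (w i)) = (List.ofFn w).map (ι F) := by rw [List.map_ofFn]; rfl
  rw [hv, hw, prod_map_iota_mul_prod_map_iota, List.length_ofFn, List.length_ofFn]

end OddCalculus

section TwoNode

variable {F : Type*} [Field F] {M : Type*} [AddCommGroup M] [Module F M]
variable {n m : ℕ} (x y : Fin n → M) (c : Fin n → F) (x' y' : Fin m → M) (c' : Fin m → F)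

/-! Abbreviations used in the docstrings (no notation and no definitions are declared; in the
statements the corresponding expressions are bound to variables `Q₁ Q₂ Q₁' Q₂' W W'` by defining
hypotheses): for a node `t : F`, `Q[t] = ν₁(t) ∧ ⋯ ∧ νₙ(t)` with `νₐ(t) = yₐ + t cₐ xₐ` on the
σ-slots, `Q'[t]` the same on the σ̄-slots (`m` of them; `m = n` for a Weil datum),
`N[t] = Q[t] * Q'[t]` (the node spinor = symbol of `e^{t h}`), `E = (x₁ ∧ y₁) ⋯ (xₙ ∧ yₙ)` (volume
of `S₁ ⊕ ⋯ ⊕ Sₙ`, the symbol of `w` up to the dictionary sign), `E'` the same on the σ̄-slots (`w̄`),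
`C = ∏ cₐ`, `C' = ∏ c'_b`; below `Q₁ = Q[t₁]`, `Q₂ = Q[t₂]`, `Q₁' = Q'[t₁]`, `Q₂' = Q'[t₂]`, `W = E`,
`W' = E'`. -/

/-- Slotwise: `∏ₐ νₐ(t₁) ∧ νₐ(t₂) = (∏ₐ cₐ) (t₁ − t₂)ⁿ · E`. [folklore] -/
theorem prod_nu_mul_nu_eq_smul_E (t₁ t₂ : F) :
    (List.ofFn fun a : Fin n => ι F (y a + (t₁ * c a) • x a) * ι F (y a + (t₂ * c a) • x a)).prod
      = ((∏ a : Fin n, c a) * (t₁ - t₂) ^ n) •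
        (List.ofFn fun a : Fin n => ι F (x a) * ι F (y a)).prod := by
  have h1 : (List.ofFn fun a : Fin n => ι F (y a + (t₁ * c a) • x a) * ι F (y a + (t₂ * c a) • x a))
      = (List.ofFn fun a : Fin n => (c a * (t₁ - t₂), ι F (x a) * ι F (y a))).map
          (fun p => p.1 • p.2) := by
    rw [List.map_ofFn]
    congr 1
    funext a
    simp only [Function.comp_apply, slot_nu_mul_nu]
  rw [h1, prod_map_smul, List.map_ofFn, List.map_ofFn]
  congr 1
  simp only [Function.comp_def, List.prod_ofFn, Finset.prod_mul_distrib, Finset.prod_const,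
    Finset.card_univ, Fintype.card_fin]

/-- Riffle: `∏ₐ νₐ(t₁) ∧ νₐ(t₂) = (−1)^{n choose 2} · Q[t₁] * Q[t₂]`. [folklore] -/
theorem prod_nu_mul_nu_eq_smul_QQ (t₁ t₂ : F) :
    (List.ofFn fun a : Fin n => ι F (y a + (t₁ * c a) • x a) * ι F (y a + (t₂ * c a) • x a)).prod
      = ((-1 : F) ^ (n.choose 2)) •
        ((List.ofFn fun a : Fin n => ι F (y a + (t₁ * c a) • x a)).prod *
          (List.ofFn fun a : Fin n => ι F (y a + (t₂ * c a) • x a)).prod) := by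
  have h1 : (List.ofFn fun a : Fin n => ι F (y a + (t₁ * c a) • x a) * ι F (y a + (t₂ * c a) • x a))
      = (List.ofFn fun a : Fin n => (y a + (t₁ * c a) • x a, y a + (t₂ * c a) • x a)).map
          (fun p => ι F p.1 * ι F p.2) := by
    rw [List.map_ofFn]; rfl
  rw [h1, prod_map_pair, List.length_ofFn, List.map_ofFn, List.map_ofFn]
  rfl

/-- Hence `(∏ cₐ)(t₁ − t₂)ⁿ · E = (−1)^{n choose 2} · Q[t₁] Q[t₂]`: the `w`-corner is the volume of
the same `2n`-plane `Q₁₃ ⊕ Q₂₃` as the mixed node corner. [folklore] -/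
theorem smul_E_eq_smul_QQ (t₁ t₂ : F) {Q₁ Q₂ W : ExteriorAlgebra F M}
    (hQ₁ : Q₁ = (List.ofFn fun a : Fin n => ι F (y a + (t₁ * c a) • x a)).prod)
    (hQ₂ : Q₂ = (List.ofFn fun a : Fin n => ι F (y a + (t₂ * c a) • x a)).prod)
    (hW : W = (List.ofFn fun a : Fin n => ι F (x a) * ι F (y a)).prod) :
    ((∏ a : Fin n, c a) * (t₁ - t₂) ^ n) • W = ((-1 : F) ^ (n.choose 2)) • (Q₁ * Q₂) := by
  subst hQ₁ hQ₂ hW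
  rw [← prod_nu_mul_nu_eq_smul_E, prod_nu_mul_nu_eq_smul_QQ]

/-- Field form: `E = ((−1)^{n choose 2} / ((∏ cₐ)(t₁ − t₂)ⁿ)) · Q[t₁] Q[t₂]` when all `cₐ ≠ 0` and
`t₁ ≠ t₂`. [folklore] -/
theorem E_eq_smul_QQ (t₁ t₂ : F) (hc : (∏ a : Fin n, c a) ≠ 0) (ht : t₁ ≠ t₂)
    {Q₁ Q₂ W : ExteriorAlgebra F M}
    (hQ₁ : Q₁ = (List.ofFn fun a : Fin n => ι F (y a + (t₁ * c a) • x a)).prod)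
    (hQ₂ : Q₂ = (List.ofFn fun a : Fin n => ι F (y a + (t₂ * c a) • x a)).prod)
    (hW : W = (List.ofFn fun a : Fin n => ι F (x a) * ι F (y a)).prod) :
    W = ((-1 : F) ^ (n.choose 2) / ((∏ a : Fin n, c a) * (t₁ - t₂) ^ n)) • (Q₁ * Q₂) := by
  have hD : (∏ a : Fin n, c a) * (t₁ - t₂) ^ n ≠ 0 :=
    mul_ne_zero hc (pow_ne_zero _ (sub_ne_zero.mpr ht))
  rw [div_eq_inv_mul, ← smul_smul, ← smul_E_eq_smul_QQ x y c t₁ t₂ hQ₁ hQ₂ hW, smul_smul,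
    inv_mul_cancel₀ hD, one_smul]

/-- **Corner expansion of a two-node symbol (THEOREM GRID, step (ii), every `n`).** The symbol
`r₁ N[t₁] + r₂ N[t₂] + κ E + κ' E'` of a two-node class `r₁ e^{t₁h} + r₂ e^{t₂h} + λ w + λ' w̄`
(`κ = ±λ`, `κ' = ±λ'` by the dictionary of the note, §1) is the four-corner grid sum on
`{Q[t₁]Q'[t₁], Q[t₂]Q'[t₂]; Q[t₁]Q[t₂], Q'[t₁]Q'[t₂]}` with the displayed coefficients. [folklore] -/
theorem twoNode_corner_expansion (t₁ t₂ : F) (hc : (∏ a : Fin n, c a) ≠ 0)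
    (hc' : (∏ b : Fin m, c' b) ≠ 0) (ht : t₁ ≠ t₂) {Q₁ Q₂ Q₁' Q₂' W W' : ExteriorAlgebra F M}
    (hQ₁ : Q₁ = (List.ofFn fun a : Fin n => ι F (y a + (t₁ * c a) • x a)).prod)
    (hQ₂ : Q₂ = (List.ofFn fun a : Fin n => ι F (y a + (t₂ * c a) • x a)).prod)
    (hQ₁' : Q₁' = (List.ofFn fun b : Fin m => ι F (y' b + (t₁ * c' b) • x' b)).prod)
    (hQ₂' : Q₂' = (List.ofFn fun b : Fin m => ι F (y' b + (t₂ * c' b) • x' b)).prod)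
    (hW : W = (List.ofFn fun a : Fin n => ι F (x a) * ι F (y a)).prod)
    (hW' : W' = (List.ofFn fun b : Fin m => ι F (x' b) * ι F (y' b)).prod) (r₁ r₂ κ κ' : F) :
    r₁ • (Q₁ * Q₁') + r₂ • (Q₂ * Q₂') + κ • W + κ' • W' =
      r₁ • (Q₁ * Q₁') + r₂ • (Q₂ * Q₂') +
        (κ * ((-1 : F) ^ (n.choose 2) / ((∏ a : Fin n, c a) * (t₁ - t₂) ^ n))) • (Q₁ * Q₂) +
        (κ' * ((-1 : F) ^ (m.choose 2) / ((∏ b : Fin m, c' b) * (t₁ - t₂) ^ m))) • (Q₁' * Q₂') := by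
  rw [E_eq_smul_QQ x y c t₁ t₂ hc ht hQ₁ hQ₂ hW, E_eq_smul_QQ x' y' c' t₁ t₂ hc' ht hQ₁' hQ₂' hW',
    smul_smul, smul_smul]

/-- **Corner expansion of a product of two two-spinor factors** on the grid
(`β₁ = α Q[t₁] + α' Q'[t₂] ∈ Λⁿ(Q₁₃ ⊕ Q₂₄)`, `β₂ = δ Q'[t₁] + δ' Q[t₂] ∈ Λᵐ(Q₁₄ ⊕ Q₂₃)`):
the four corner coefficients are `αδ, (−1)^{mn} α'δ', αδ', (−1)^{m²} α'δ` — so `c₁c₂ = c₃c₄` when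
`m = n` (grid invariant `μ = 1`). [folklore] -/
theorem boxProduct_corner_expansion (t₁ t₂ : F) {Q₁ Q₂ Q₁' Q₂' : ExteriorAlgebra F M}
    (hQ₁ : Q₁ = (List.ofFn fun a : Fin n => ι F (y a + (t₁ * c a) • x a)).prod)
    (hQ₂ : Q₂ = (List.ofFn fun a : Fin n => ι F (y a + (t₂ * c a) • x a)).prod)
    (hQ₁' : Q₁' = (List.ofFn fun b : Fin m => ι F (y' b + (t₁ * c' b) • x' b)).prod)
    (hQ₂' : Q₂' = (List.ofFn fun b : Fin m => ι F (y' b + (t₂ * c' b) • x' b)).prod)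
    (α α' δ δ' : F) :
    (α • Q₁ + α' • Q₂') * (δ • Q₁' + δ' • Q₂) =
      (α * δ) • (Q₁ * Q₁') + ((-1 : F) ^ (m * n) * (α' * δ')) • (Q₂ * Q₂') +
        (α * δ') • (Q₁ * Q₂) + ((-1 : F) ^ (m * m) * (α' * δ)) • (Q₁' * Q₂') := by
  subst hQ₁ hQ₂ hQ₁' hQ₂'
  rw [add_mul, mul_add, mul_add, smul_mul_smul_comm, smul_mul_smul_comm, smul_mul_smul_comm,
    smul_mul_smul_comm,
    ofFn_iota_mul_ofFn_iota (fun b : Fin m => y' b + (t₂ * c' b) • x' b)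
      (fun b : Fin m => y' b + (t₁ * c' b) • x' b),
    ofFn_iota_mul_ofFn_iota (fun b : Fin m => y' b + (t₂ * c' b) • x' b)
      (fun a : Fin n => y a + (t₂ * c a) • x a),
    smul_smul, smul_smul]
  module

end TwoNode

section Law

variable {F : Type*} [Field F] {M : Type*} [AddCommGroup M] [Module F M]
variable {n : ℕ} (x y x' y' : Fin n → M) (c c' : Fin n → F)

/-- `((-1)^k)² = 1`. [folklore] -/
theorem neg_one_pow_mul_self_eq_one (k : ℕ) : ((-1 : F) ^ k) * ((-1 : F) ^ k) = 1 := by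
  rw [← pow_add, ← two_mul, pow_mul, neg_one_sq, one_pow]

/-- **THE GRID LAW (THEOREM GRID, step (ii), every `n`).** On a Weil datum (`n` σ-slots with
weights `cₐ`, `n` σ̄-slots with weights `c'_b`, `∏ cₐ ≠ 0 ≠ ∏ c'_b`; nodes `t₁ ≠ t₂`), if the
two-node symbol `r₁ N[t₁] + r₂ N[t₂] + κ E + κ' E'` is a product of two two-spinor factors on the
grid and the four corners are linearly independent (leaf 3b: true whenever the `4n` vectors
`xₐ, yₐ, x'_b, y'_b` are), then `κ κ' = r₁ r₂ · (∏ cₐ ∏ c'_b) · (t₁ − t₂)^{2n}`. With the dictionary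
`κκ' = ±λλ'` this is the note's law `|λλ'| = |r₁r₂| ∏c |t₁ − t₂|^{2n}`, i.e. `μ = 1`. [folklore] -/
theorem gridLaw_of_boxProduct (t₁ t₂ : F) (hc : (∏ a : Fin n, c a) ≠ 0)
    (hc' : (∏ b : Fin n, c' b) ≠ 0) (ht : t₁ ≠ t₂) {Q₁ Q₂ Q₁' Q₂' W W' : ExteriorAlgebra F M}
    (hQ₁ : Q₁ = (List.ofFn fun a : Fin n => ι F (y a + (t₁ * c a) • x a)).prod)
    (hQ₂ : Q₂ = (List.ofFn fun a : Fin n => ι F (y a + (t₂ * c a) • x a)).prod)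
    (hQ₁' : Q₁' = (List.ofFn fun b : Fin n => ι F (y' b + (t₁ * c' b) • x' b)).prod)
    (hQ₂' : Q₂' = (List.ofFn fun b : Fin n => ι F (y' b + (t₂ * c' b) • x' b)).prod)
    (hW : W = (List.ofFn fun a : Fin n => ι F (x a) * ι F (y a)).prod)
    (hW' : W' = (List.ofFn fun b : Fin n => ι F (x' b) * ι F (y' b)).prod)
    (hind : LinearIndependent F ![Q₁ * Q₁', Q₂ * Q₂', Q₁ * Q₂, Q₁' * Q₂'])
    (r₁ r₂ κ κ' α α' δ δ' : F)
    (hbox : r₁ • (Q₁ * Q₁') + r₂ • (Q₂ * Q₂') + κ • W + κ' • W' =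
      (α • Q₁ + α' • Q₂') * (δ • Q₁' + δ' • Q₂)) :
    κ * κ' = r₁ * r₂ * ((∏ a : Fin n, c a) * (∏ b : Fin n, c' b)) * (t₁ - t₂) ^ (2 * n) := by
  set s : F := (-1 : F) ^ (n.choose 2) with hs_def
  set s₂ : F := (-1 : F) ^ (n * n) with hs₂_def
  have hs : s * s = 1 := neg_one_pow_mul_self_eq_one _
  have hD : (∏ a : Fin n, c a) * (t₁ - t₂) ^ n ≠ 0 :=
    mul_ne_zero hc (pow_ne_zero _ (sub_ne_zero.mpr ht))
  have hD' : (∏ b : Fin n, c' b) * (t₁ - t₂) ^ n ≠ 0 :=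
    mul_ne_zero hc' (pow_ne_zero _ (sub_ne_zero.mpr ht))
  have h4 := twoNode_corner_expansion x y c x' y' c' t₁ t₂ hc hc' ht hQ₁ hQ₂ hQ₁' hQ₂' hW hW'
    r₁ r₂ κ κ'
  have h5 := boxProduct_corner_expansion x y c x' y' c' t₁ t₂ hQ₁ hQ₂ hQ₁' hQ₂' α α' δ δ'
  have H := (h4.symm.trans hbox).trans h5
  -- compare coefficients on the four independent corners
  have key := Fintype.linearIndependent_iff.mp hind
    ![r₁ - α * δ, r₂ - s₂ * (α' * δ'), κ * (s / ((∏ a : Fin n, c a) * (t₁ - t₂) ^ n)) - α * δ',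
      κ' * (s / ((∏ b : Fin n, c' b) * (t₁ - t₂) ^ n)) - s₂ * (α' * δ)] (by
      rw [Fin.sum_univ_four]
      simp only [Matrix.cons_val_zero, Matrix.cons_val_one, Matrix.cons_val]
      rw [sub_smul, sub_smul, sub_smul, sub_smul]
      rw [← sub_eq_zero] at H
      rw [← H]
      abel)
  have e0 : r₁ = α * δ := sub_eq_zero.mp (by simpa using key 0)
  have e1 : r₂ = s₂ * (α' * δ') := sub_eq_zero.mp (by simpa using key 1)
  have e2 : κ * (s / ((∏ a : Fin n, c a) * (t₁ - t₂) ^ n)) = α * δ' :=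
    sub_eq_zero.mp (by simpa using key 2)
  have e3 : κ' * (s / ((∏ b : Fin n, c' b) * (t₁ - t₂) ^ n)) = s₂ * (α' * δ) :=
    sub_eq_zero.mp (by simpa using key 3)
  have e2' : κ * s = α * δ' * ((∏ a : Fin n, c a) * (t₁ - t₂) ^ n) := by
    rw [← mul_div_assoc, div_eq_iff hD] at e2; exact e2
  have e3' : κ' * s = s₂ * (α' * δ) * ((∏ b : Fin n, c' b) * (t₁ - t₂) ^ n) := by
    rw [← mul_div_assoc, div_eq_iff hD'] at e3; exact e3
  calc κ * κ' = (κ * s) * (κ' * s) := by rw [mul_mul_mul_comm, hs, mul_one]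
    _ = (α * δ' * ((∏ a : Fin n, c a) * (t₁ - t₂) ^ n)) *
          (s₂ * (α' * δ) * ((∏ b : Fin n, c' b) * (t₁ - t₂) ^ n)) := by rw [e2', e3']
    _ = (α * δ) * (s₂ * (α' * δ')) * ((∏ a : Fin n, c a) * (∏ b : Fin n, c' b)) *
          (t₁ - t₂) ^ (2 * n) := by ring
    _ = r₁ * r₂ * ((∏ a : Fin n, c a) * (∏ b : Fin n, c' b)) * (t₁ - t₂) ^ (2 * n) := by
          rw [← e0, ← e1]

end Law

end Summit.Ventures.HSemireg
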